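import Summits.SmoothPoincare4.SmoothPoincare4.Theorems.EntropyRungChangGurskyYangStubSmoothRoundLimitAux10
import HarnessLib

/-!
# Decay of the covariant Ricci derivatives of the scaled flow, by interpolation, II: base and induction
(helper file 11 for stub `stub_smoothRoundLimit`, line `margerin-cone-hamilton-rails`, crux
`EntropyRung.ChangGurskyYang`, item stmt-SmoothPoincare4-10834)

Sequel of helper file 10 (same coordinate setting on a closed chart ball `B̄(y₀, R) ⊆ V` along a
smooth family `G_t`, `t ∈ [t₀, T)`, `h = T − t`; logarithmic bounds of `Γ`, `∂Γ`, bounded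
components of all `∇ᵏRic`):

* `tcovIter_ric2_decay_base` — **the base of the induction**: the decay
  `|Ric_J − (2h)⁻¹ G_J| ≤ D₀ h^{δ₀}` of the round defect gives `|(∇Ric)_J| ≤ C h^{δ₀/4}` on a
  smaller ball (Landau interpolation of the defect components, whose covariant derivative IS
  `∇Ric` because `∇g = 0`);
* `tcovIter_ric2_decay` — **for every `k` there are `θ_k > 0`, `C_k` with
  `|(∇ᵏ⁺¹Ric)_J| ≤ C_k h^{θ_k}` on `B̄(y₀, R/2) × [t₀, T)`** (induction on shrinking balls
  `B̄(y₀, R/2 + R/2^{k+2})`, steps by `tcovIter_ric2_decay_step`);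
* `helper_tcovIter_ric2_decay` — its registered form.

This is Hamilton 1982, §17 (decay of all `∇ᵏRic` for the normalised flow, Thm. 17.6 and
Cor. 17.10), with polynomial instead of exponential rates, obtained here by pointwise Landau
interpolation in a chart rather than by the integral interpolation inequalities of §12.

## References

* R. S. Hamilton, *Three-manifolds with positive Ricci curvature*, J. Differential Geom. 17
  (1982) 255–306, §12, §14 (Lemma 14.2 ff.), §17 (Thm. 17.6, Cor. 17.10). [Hamilton1982]
-/

noncomputable section

-- every `Summit.SmoothPoincare4.SmoothPoincare4.…` name repeats the summit = sub-problem segment (D-0017 layout)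
set_option linter.dupNamespace false

-- operator spaces of bilinear forms over the model space
set_option maxSynthPendingDepth 3

open Set Function Filter Real Module Metric
open scoped Topology ContDiff

namespace Summit.SmoothPoincare4.SmoothPoincare4.Theorems.MargerinRails

open Literature.Geometry.Lorentzian Literature.Geometry.Lorentzian.MetricCoord
open Literature.Geometry.Riemannian (coordSum coordSum_nonneg)

universe u

section Decay

variable {E : Type u} [NormedAddCommGroup E] [NormedSpace ℝ E] [FiniteDimensional ℝ E]
  [CompleteSpace E] {ι : Type*} [Fintype ι] (b : Basis ι ℝ E)
  {G : ℝ → E → E →L[ℝ] E →L[ℝ] ℝ} {V : Set E} {t₀ T : ℝ} {y₀ : E} {R : ℝ}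
  (hG : IsMetricFamilyOn G (Ico t₀ T) V) (ht₀ : t₀ < T) (hKV : closedBall y₀ R ⊆ V)
  {A₀ : ℝ} (hA₀ : 0 ≤ A₀) (hΓ : ∀ t ∈ Ico t₀ T, ∀ y ∈ closedBall y₀ R, ∀ j i m : ι,
    |chrCoef (G t) b y j i m| ≤ A₀ * (1 + Real.log ((T - t₀) / (T - t))))
  {A₁ : ℝ} (hA₁ : 0 ≤ A₁) (hdΓ : ∀ t ∈ Ico t₀ T, ∀ y ∈ closedBall y₀ R, ∀ p j i m : ι,
    |pd b p (fun y' ↦ chrCoef (G t) b y' j i m) y| ≤ A₁ * (1 + Real.log ((T - t₀) / (T - t))) ^ 2)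
  (hRk : ∀ k : ℕ, ∃ Ck : ℝ, ∀ t ∈ Ico t₀ T, ∀ y ∈ closedBall y₀ R, ∀ J : Fin k ⊕ Fin 2 → ι,
    |tcovIter (G t) b k (ric2 (G t) b) y J| ≤ Ck)
  {D₀ δ₀ : ℝ} (hδ₀ : 0 < δ₀)
  (hD : ∀ t ∈ Ico t₀ T, ∀ y ∈ closedBall y₀ R, ∀ J : Fin 0 ⊕ Fin 2 → ι,
    |tcovIter (G t) b 0 (ric2 (G t) b) y J -
      (2 * (T - t))⁻¹ * G t y (b (J (Sum.inr 0))) (b (J (Sum.inr 1)))| ≤ D₀ * (T - t) ^ δ₀)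

include hG ht₀ hKV hA₀ hΓ hA₁ hdΓ hRk hδ₀ hD

/-- **The base of the induction**: the decay of the round defect `φ_J = Ric_J − (2h)⁻¹ G_J` at rate
`δ₀` on `B̄(y₀, R)` gives the decay of `∇Ric` at rate `δ₀/4` on `B̄(y₀, ρ')`, `ρ' < R`: Landau
interpolation of `φ_J` between `|φ| ≤ D₀ h^{δ₀}` and `|∂∂φ| = O((1 + log)²)`
(`abs_pd_pd_defect_le`), then `(∇Ric) = ∂φ − Γ ⋆ φ` (`abs_tcovIter_one_le_pd_defect`).
[cite: Hamilton1982, §17, Thm. 17.6] -/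
theorem tcovIter_ric2_decay_base {ρ' : ℝ} (hρ'R : ρ' < R) :
    ∃ C' : ℝ, ∀ t ∈ Ico t₀ T, ∀ y ∈ closedBall y₀ ρ', ∀ J : Fin 1 ⊕ Fin 2 → ι,
      |tcovIter (G t) b 1 (ric2 (G t) b) y J| ≤ C' * (T - t) ^ (δ₀ / 4) := by
  have hV : IsOpen V := hG.isOpen ⟨le_rfl, ht₀⟩
  have hT₀ : 0 < T - t₀ := sub_pos.2 ht₀
  -- the constants
  obtain ⟨C₁, hC₁⟩ := hRk 1
  obtain ⟨C₂, hC₂⟩ := hRk 2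
  set n : ℝ := (Fintype.card ι : ℝ) with hn
  set a₀ : ℝ := Fintype.card (Fin 0 ⊕ Fin 2) * n with ha₀
  set a₁ : ℝ := Fintype.card (Fin 1 ⊕ Fin 2) * n with ha₁
  set Φ₀ : ℝ := |D₀| * (T - t₀) ^ δ₀ with hΦ₀
  have hΦ₀nn : 0 ≤ Φ₀ := by positivity
  set Bq : ℝ := (|C₂| + a₁ * (A₀ * |C₁|)) + a₀ * (A₁ * Φ₀ + A₀ * (|C₁| + a₀ * (A₀ * Φ₀))) with hBq
  have hBq0 : 0 ≤ Bq := by positivity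
  set Kℓ : ℝ := (1 + 1 / (δ₀ / 8)) ^ 2 * (T - t₀) ^ (2 * (δ₀ / 8)) with hKℓ
  have hKℓ0 : 0 ≤ Kℓ := by positivity
  have hlog : ∀ t ∈ Ico t₀ T, (1 + Real.log ((T - t₀) / (T - t))) ^ 2 ≤ Kℓ * (T - t) ^ (-(δ₀ / 4)) := by
    intro t ht
    have := one_add_log_ratio_sq_le ht (by positivity : 0 < δ₀ / 8)
    rw [show 2 * (δ₀ / 8) = δ₀ / 4 by ring] at this
    rw [hKℓ, show 2 * (δ₀ / 8) = δ₀ / 4 by ring]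
    exact this
  set D : ℝ := |D₀| with hDdef
  set B : ℝ := Bq * Kℓ with hB
  have hB0 : 0 ≤ B := by positivity
  set r' : ℝ := R - ρ' with hr'
  have hr'0 : 0 < r' := by rw [hr']; linarith
  set K : ℝ := 2 * D * (T - t₀) ^ (δ₀ / 4) + coordSum b ^ 2 * Fintype.card ι ^ 2 * B +
    (4 * D * (T - t₀) ^ δ₀ / r' + r' / 2 * (coordSum b ^ 2 * Fintype.card ι ^ 2 * B) * (r' / 2) ^ (-(1 / 2 : ℝ))) *
      (r' / 2) ^ (-(1 / 2 : ℝ)) with hK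
  set Bb : ℝ := ∑ q, ‖b q‖ with hBb
  refine ⟨Bb * K + a₀ * (A₀ * D) * Kℓ * (T - t₀) ^ (δ₀ / 2), fun t ht y hy J' ↦ ?_⟩
  have hTt : 0 < T - t := sub_pos.2 ht.2
  have hhle : T - t ≤ T - t₀ := by linarith [ht.1]
  obtain ⟨-, hℓ0⟩ := log_ratio_eq ht
  have hX : 1 ≤ 1 + Real.log ((T - t₀) / (T - t)) := by linarith
  have hyR : y ∈ closedBall y₀ R := closedBall_subset_closedBall hρ'R.le hy
  have hyV : y ∈ V := hKV hyR
  have hGt : IsMetricOn (G t) V := hG.isMetricOn t ht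
  -- the defect at `y`, with its decaying and its crude bounds
  have hΦy : ∀ y' ∈ closedBall y₀ R, ∀ J : Fin 0 ⊕ Fin 2 → ι,
      |tcovIter (G t) b 0 (ric2 (G t) b) y' J -
        (2 * (T - t))⁻¹ * G t y' (b (J (Sum.inr 0))) (b (J (Sum.inr 1)))| ≤ D * (T - t) ^ δ₀ :=
    fun y' hy' J ↦ (hD t ht y' hy' J).trans (mul_le_mul_of_nonneg_right (le_abs_self _) (rpow_nonneg hTt.le _))
  have hΦcrude : ∀ y' ∈ closedBall y₀ R, ∀ J : Fin 0 ⊕ Fin 2 → ι,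
      |tcovIter (G t) b 0 (ric2 (G t) b) y' J -
        (2 * (T - t))⁻¹ * G t y' (b (J (Sum.inr 0))) (b (J (Sum.inr 1)))| ≤ Φ₀ :=
    fun y' hy' J ↦ (hΦy y' hy' J).trans (mul_le_mul_of_nonneg_left (rpow_le_rpow hTt.le hhle hδ₀.le) (abs_nonneg _))
  -- Step 1: `R_1` through `∂φ`
  have hstep := abs_tcovIter_one_le_pd_defect b hGt ((2 * (T - t))⁻¹) hyV (hΓ t ht y hyR) (hΦy y hyR) J'
  set q : ι := J' (shiftEquiv 0 (Fin 2) none) with hq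
  set J : Fin 0 ⊕ Fin 2 → ι := (J' ∘ ⇑(shiftEquiv 0 (Fin 2))) ∘ some with hJ
  set φ : E → ℝ := fun z ↦ tcovIter (G t) b 0 (ric2 (G t) b) z J -
    (2 * (T - t))⁻¹ * G t z (b (J (Sum.inr 0))) (b (J (Sum.inr 1))) with hφ
  -- Step 2: the engine for `φ`
  have hφs : ContDiffOn ℝ ∞ φ V :=
    ((hGt.tsmoothOn_tcovIter (hGt.tsmoothOn_ric2 (b := b)) 0) J).sub
      (contDiffOn_const.mul ((hGt.contDiffOn.clm_apply contDiffOn_const).clm_apply contDiffOn_const))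
  have hballR : ball y r' ⊆ closedBall y₀ R := ball_subset_closedBall_of_mem hy
  have hballV : ball y r' ⊆ V := hballR.trans hKV
  have h0 : ∀ y' ∈ ball y r', |φ y'| ≤ D * (T - t) ^ δ₀ := fun y' hy' ↦ hΦy y' (hballR hy') J
  have h2 : ∀ y' ∈ ball y r', ∀ p q' : ι, |pd b p (pd b q' φ) y'| ≤ B * (T - t) ^ (-(δ₀ / 4)) := by
    intro y' hy' p q'
    have hy'R : y' ∈ closedBall y₀ R := hballR hy'
    have hy'V : y' ∈ V := hKV hy'R
    have key := abs_pd_pd_defect_le b hGt ((2 * (T - t))⁻¹) hy'V (hΓ t ht y' hy'R) (hdΓ t ht y' hy'R)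
      (hΦcrude y' hy'R) (fun J ↦ (hC₁ t ht y' hy'R J).trans (le_abs_self _))
      (fun J ↦ (hC₂ t ht y' hy'R J).trans (le_abs_self _)) p q' J
    have hshape := quad_shape_le (A₁ := A₁) (c₀ := Φ₀) (c₁ := |C₁|) (c₂ := |C₂|) (a := a₁) (a' := a₀) hX hA₀
      (abs_nonneg _) (abs_nonneg _) (by positivity) (by positivity)
    calc _ ≤ _ := key
      _ ≤ Bq * (1 + Real.log ((T - t₀) / (T - t))) ^ 2 := hshape
      _ ≤ Bq * (Kℓ * (T - t) ^ (-(δ₀ / 4))) := mul_le_mul_of_nonneg_left (hlog t ht) hBq0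
      _ = B * (T - t) ^ (-(δ₀ / 4)) := by rw [hB]; ring
  have hengine := norm_fderiv_le_rpow_of_bounds b hV hφs hr'0 hballV hδ₀ hTt hhle (abs_nonneg D₀) hB0 h0 h2
  rw [← hK] at hengine
  -- Step 3: assemble
  have hpd : |pd b q φ y| ≤ Bb * K * (T - t) ^ (δ₀ / 4) := by
    refine (abs_pd_le_norm_fderiv b φ y q).trans ?_
    have hbq : ‖b q‖ ≤ Bb := Finset.single_le_sum (f := fun q ↦ ‖b q‖) (fun _ _ ↦ norm_nonneg _) (Finset.mem_univ q)
    have hK0 : 0 ≤ K * (T - t) ^ (δ₀ / 4) := le_trans (norm_nonneg _) hengine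
    calc ‖fderiv ℝ φ y‖ * ‖b q‖ ≤ (K * (T - t) ^ (δ₀ / 4)) * Bb := mul_le_mul hengine hbq (norm_nonneg _) hK0
      _ = Bb * K * (T - t) ^ (δ₀ / 4) := by ring
  have htail : (Fintype.card (Fin 0 ⊕ Fin 2) : ℝ) * Fintype.card ι *
      (A₀ * (1 + Real.log ((T - t₀) / (T - t))) * (D * (T - t) ^ δ₀)) ≤
      a₀ * (A₀ * D) * Kℓ * (T - t₀) ^ (δ₀ / 2) * (T - t) ^ (δ₀ / 4) := by
    have hX2 : (1 + Real.log ((T - t₀) / (T - t))) ≤ (1 + Real.log ((T - t₀) / (T - t))) ^ 2 :=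
      le_self_pow₀ hX two_ne_zero
    have h2' : (1 + Real.log ((T - t₀) / (T - t))) ≤ Kℓ * (T - t) ^ (-(δ₀ / 4)) := hX2.trans (hlog t ht)
    have h3 : (T - t) ^ (-(δ₀ / 4)) * (T - t) ^ δ₀ ≤ (T - t₀) ^ (δ₀ / 2) * (T - t) ^ (δ₀ / 4) := by
      rw [← rpow_add hTt]
      have := rpow_le_mul_rpow (a := -(δ₀ / 4) + δ₀) (c := δ₀ / 4) hTt hhle (by linarith)
      rw [show -(δ₀ / 4) + δ₀ - δ₀ / 4 = δ₀ / 2 by ring] at this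
      exact this
    have hD0 : 0 ≤ D := abs_nonneg _
    have h4 : A₀ * (1 + Real.log ((T - t₀) / (T - t))) * (D * (T - t) ^ δ₀) ≤
        A₀ * (Kℓ * (T - t) ^ (-(δ₀ / 4))) * (D * (T - t) ^ δ₀) :=
      mul_le_mul_of_nonneg_right (mul_le_mul_of_nonneg_left h2' hA₀) (by positivity)
    have ha₀0 : 0 ≤ a₀ := by positivity
    calc (Fintype.card (Fin 0 ⊕ Fin 2) : ℝ) * Fintype.card ι *
          (A₀ * (1 + Real.log ((T - t₀) / (T - t))) * (D * (T - t) ^ δ₀))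
        = a₀ * (A₀ * (1 + Real.log ((T - t₀) / (T - t))) * (D * (T - t) ^ δ₀)) := by rw [ha₀, hn]
      _ ≤ a₀ * (A₀ * (Kℓ * (T - t) ^ (-(δ₀ / 4))) * (D * (T - t) ^ δ₀)) := mul_le_mul_of_nonneg_left h4 ha₀0
      _ = a₀ * (A₀ * D) * Kℓ * ((T - t) ^ (-(δ₀ / 4)) * (T - t) ^ δ₀) := by ring
      _ ≤ a₀ * (A₀ * D) * Kℓ * ((T - t₀) ^ (δ₀ / 2) * (T - t) ^ (δ₀ / 4)) :=
          mul_le_mul_of_nonneg_left h3 (by positivity)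
      _ = _ := by ring
  calc |tcovIter (G t) b 1 (ric2 (G t) b) y J'| ≤ _ := hstep
    _ ≤ Bb * K * (T - t) ^ (δ₀ / 4) + a₀ * (A₀ * D) * Kℓ * (T - t₀) ^ (δ₀ / 2) * (T - t) ^ (δ₀ / 4) :=
        add_le_add hpd htail
    _ = _ := by ring

/-- **Decay of all covariant Ricci derivatives of the scaled flow in the chart** (Hamilton 1982,
§17, Thm. 17.6, Cor. 17.10, polynomial rates): for every `k` there are `θ > 0` and `C` with
`|(∇ᵏ⁺¹Ric)_J (y, t)| ≤ C (T−t)^θ` for `y ∈ B̄(y₀, R/2)`, `t ∈ [t₀, T)` — induction on `k` on the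
balls `B̄(y₀, R/2 + R/2^{k+2})` with `tcovIter_ric2_decay_base` and `tcovIter_ric2_decay_step`.
[cite: Hamilton1982, §17, Thm. 17.6, Cor. 17.10] -/
theorem tcovIter_ric2_decay (hR : 0 < R) (k : ℕ) :
    ∃ θ : ℝ, 0 < θ ∧ ∃ C : ℝ, ∀ t ∈ Ico t₀ T, ∀ y ∈ closedBall y₀ (R / 2), ∀ J : Fin (k + 1) ⊕ Fin 2 → ι,
      |tcovIter (G t) b (k + 1) (ric2 (G t) b) y J| ≤ C * (T - t) ^ θ := by
  -- the claim on the shrinking balls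
  have main : ∀ k : ℕ, ∃ θ : ℝ, 0 < θ ∧ ∃ C : ℝ, ∀ t ∈ Ico t₀ T,
      ∀ y ∈ closedBall y₀ (R / 2 + R / 2 ^ (k + 2)), ∀ J : Fin (k + 1) ⊕ Fin 2 → ι,
      |tcovIter (G t) b (k + 1) (ric2 (G t) b) y J| ≤ C * (T - t) ^ θ := by
    intro k
    induction k with
    | zero =>
      obtain ⟨C', hC'⟩ := tcovIter_ric2_decay_base b hG ht₀ hKV hA₀ hΓ hA₁ hdΓ hRk hδ₀ hD
        (ρ' := R / 2 + R / 2 ^ (0 + 2)) (by norm_num; linarith)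
      exact ⟨δ₀ / 4, by positivity, C', hC'⟩
    | succ k ih =>
      obtain ⟨θ, hθ, C, hC⟩ := ih
      have hpow : (0 : ℝ) < 2 ^ (k + 2) := by positivity
      have hlt : R / 2 + R / 2 ^ (k + 1 + 2) < R / 2 + R / 2 ^ (k + 2) := by
        have : R / 2 ^ (k + 1 + 2) < R / 2 ^ (k + 2) := by
          apply div_lt_div_of_pos_left hR hpow
          exact pow_lt_pow_right₀ (by norm_num) (by omega)
        linarith
      have hle : R / 2 + R / 2 ^ (k + 2) ≤ R := by
        have h4 : (4 : ℝ) ≤ 2 ^ (k + 2) := by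
          have : (2 : ℝ) ^ 2 ≤ 2 ^ (k + 2) := pow_le_pow_right₀ (by norm_num) (by omega)
          norm_num at this; exact this
        have : R / 2 ^ (k + 2) ≤ R / 4 := div_le_div_of_nonneg_left hR.le (by norm_num) h4
        linarith
      obtain ⟨C', hC'⟩ := tcovIter_ric2_decay_step b hG ht₀ hKV hA₀ hΓ hA₁ hdΓ hRk k hlt hle hθ hC
      exact ⟨θ / 4, by positivity, C', hC'⟩
  obtain ⟨θ, hθ, C, hC⟩ := main k
  refine ⟨θ, hθ, C, fun t ht y hy J ↦ hC t ht y (closedBall_subset_closedBall ?_ hy) J⟩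
  have : 0 ≤ R / 2 ^ (k + 2) := by positivity
  linarith

omit [CompleteSpace E] hG ht₀ hKV hA₀ hΓ hA₁ hdΓ hRk hδ₀ hD in
/-- **HELPER `helper_tcovIter_ric2_decay`** — the registered form of `tcovIter_ric2_decay`
(decay of all covariant Ricci derivatives of the scaled flow in a chart from the logarithmic bounds
of `Γ`, `∂Γ`, the bounded components of all `∇ᵏRic` and the decay of the round defect).
[cite: Hamilton1982, §17, Thm. 17.6, Cor. 17.10] -/
theorem helper_tcovIter_ric2_decay : ∀ {E : Type u} [NormedAddCommGroup E] [NormedSpace ℝ E] [FiniteDimensional ℝ E] [CompleteSpace E] {ι : Type*} [Fintype ι] (b : Module.Basis ι ℝ E) {G : ℝ → E → E →L[ℝ] E →L[ℝ] ℝ} {V : Set E} {t₀ T : ℝ} {y₀ : E} {R : ℝ}, MetricCoord.IsMetricFamilyOn G (Ico t₀ T) V → t₀ < T → Metric.closedBall y₀ R ⊆ V → ∀ {A₀ : ℝ}, 0 ≤ A₀ → (∀ t ∈ Ico t₀ T, ∀ y ∈ Metric.closedBall y₀ R, ∀ j i m : ι, |MetricCoord.chrCoef (G t) b y j i m| ≤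 A₀ * (1 + Real.log ((T - t₀) / (T - t)))) → ∀ {A₁ : ℝ}, 0 ≤ A₁ → (∀ t ∈ Ico t₀ T, ∀ y ∈ Metric.closedBall y₀ R, ∀ p j i m : ι, |MetricCoord.pd b p (fun y' ↦ MetricCoord.chrCoef (G t) b y' j i m) y| ≤ A₁ * (1 + Real.log ((T - t₀) / (T - t))) ^ 2) → (∀ k : ℕ, ∃ Ck : ℝ, ∀ t ∈ Ico t₀ T, ∀ y ∈ Metric.closedBall y₀ R, ∀ J : Fin k ⊕ Fin 2 → ι, |MetricCoord.tcovIter (G t) b k (MetricCoord.ric2 (G t) b) y J| ≤ Ck) → ∀ {D₀ δ₀ : ℝ}, 0 < δ₀ → (∀ t ∈ Ico t₀ T, ∀ y ∈ Metric.closedBall y₀ R, ∀ J : Fin 0 ⊕ Fin 2 → ι, |MetricCoord.tcovIter (G t) b 0 (MetricCoord.ric2 (G t) b) y J - (2 * (T - t))⁻¹ * G t y (b (J (Sum.inr 0))) (b (J (Sum.inr 1)))| ≤ D₀ * (T - t) ^ δ₀) → 0 < R → ∀ k : ℕ, ∃ θ : ℝ, 0 < θ ∧ ∃ C : ℝ,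 ∀ t ∈ Ico t₀ T, ∀ y ∈ Metric.closedBall y₀ (R / 2), ∀ J : Fin (k + 1) ⊕ Fin 2 → ι, |MetricCoord.tcovIter (G t) b (k + 1) (MetricCoord.ric2 (G t) b) y J| ≤ C * (T - t) ^ θ := by
  intro E _ _ _ _ ι _ b G V t₀ T y₀ R hG ht₀ hKV A₀ hA₀ hΓ A₁ hA₁ hdΓ hRk D₀ δ₀ hδ₀ hD hR k
  exact tcovIter_ric2_decay b hG ht₀ hKV hA₀ hΓ hA₁ hdΓ hRk hδ₀ hD hR k

end Decay

end Summit.SmoothPoincare4.SmoothPoincare4.Theorems.MargerinRails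

end
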